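import Summits.CriticalPhenomena.PercolationContinuityZ3.Theorems.PercNearOneGluingNoHeavyLowerTailAntitheticZones
import Summits.CriticalPhenomena.PercolationContinuityZ3.Theorems.PercNearOneGluingNoHeavyLowerTailAntitheticLatticePieces
import HarnessLib

/-!
# `NoHeavyLowerTail` (stmt-CriticalPhenomena-4575) — antithetic cluster pairs: THEOREM I (CONES) — the bicluster-avoidance sum is
# nonnegative on every apex graph for every avoidance set `R`, and on EVERY graph for one constrained neighbour of `s`
# (prim-hp-2 gen 35/36; MEMO-gen35 §4b, THEOREM-I-cones.md, MEMO-gen36 §1–§2)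

Support file (`--supports stmt-CriticalPhenomena-4575`, hull-port prover `prim-hp-2`, gen 36).  No named facts, no sorries; standard
axioms; the bookkeeping `def`s live in `…AntitheticZones` (`Antithetic.Cone.*`), the theorems are stated without them.

SETTING (MEMO-gen29 §3, MEMO-gen31 §1): colourings `ω ⊆ Sym2 V` (`ω ∩ E` red, `ωᶜ ∩ E` blue), source `s`, RED / BLUE clusters
`C_s(ω ∩ E)`, `C_s(ωᶜ ∩ E)` (BHK's open edge clusters), `Δ(ω) = (F(red) − F(blue))(G(red) − G(blue))` for increasing `F, G`.  CONJECTURE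
BIC (gen 31; implies the antithetic / coefficientwise BHK inequality SC by the peeling of MEMO-gen31 §1): for every graph, `s`, `R ∌ s`:
`0 ≤ Σ_{ω : no vertex of R is joined to s in both colours} Δ(ω)`.
* `Antithetic.cone_bic_nonneg` — THEOREM I: BIC for every `R` when `s` is adjacent to every other vertex (fans, wheels, `K_n`, cones).
* `Antithetic.bic_single_nonneg` — BIC for `R = {u}`, `u` any neighbour of `s`, on every finite graph (new in gen 36).

PROOF (THEOREM-I-cones.md, reorganised so that no connected-component bookkeeping is needed).  For `u ∈ R` with spoke `su` of colour
`χ_u` the ZONE `J_u` is the cluster of `u` in the `G − s` edges of the opposite colour; every edge of `E` into `J_u` (spokes included)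
has colour `χ_u` (`Cone.boundary_iff`).  The blocks `S(J_u)` generate the Boolean algebra `𝒜` of edge sets splitting no block; the TOP `N`
recolours every block so that its spokes are red, red elsewhere; the PART of `T` is `{N ∆ A : A ∈ 𝒜}` (zones sharing an edge flip
together automatically; two zones sharing an edge must have the same spoke colour — automatic for `|R| = 1`, and on a cone because
opposite zones neither meet nor touch: `Cone.spoke_iff_of_mem_zblock`).  (1) validity: for `A ⊆ B` in `𝒜` the zones inside `B` are
SEALED in `N ∆ B`, all other edges are at least as red in `N ∆ A` (`Cone.red_antitone`); (2) parts lie in the constraint set (a zone is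
sealed against blue when up, against red when down: `Cone.mem_constraint_of_mem_zpart`); (3) zones, blocks, algebra and top agree for
all members of a part (`Cone.zone_eq_of_agree`), so parts partition the constraint set (`Cone.zpart_eq_of_mem`); (4) Harris on `𝒜`
(`Antithetic.piece_algebra_sum_nonneg`) and (5) the partition principle (`Antithetic.sum_nonneg_of_parts`) finish.
[cite: VandenbergHaggstromKahn2005, §1 p. 6 ("Harris' inequality"), §1 p. 3 (open cluster `C_s`)]
-/

noncomputable section

namespace Summit.CriticalPhenomena.PercolationContinuityZ3.Theorems

open Literature.Probability.Percolation
open scoped Classical symmDiff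

namespace Antithetic

namespace Cone

variable {V : Type*}

section Partition

variable {E : Set (Sym2 V)} {s : V} {R : Set V} {T : Set (Sym2 V)}

/-- **Consistency of spoke colours on overlapping blocks**: in a constraint configuration of a cone, two `R`-vertices whose zone
blocks share an edge have spokes of the same colour (opposite-type zones neither meet nor touch; THEOREM-I-cones.md §1). [this work] -/
theorem spoke_iff_of_mem_zblock (hcone : ∀ v, v ≠ s → s(s, v) ∈ E) (hRs : s ∉ R)
    (hT : ∀ r ∈ R, ¬ ((openGraph (T ∩ E)).Reachable s r ∧ (openGraph (Tᶜ ∩ E)).Reachable s r))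
    {u v : V} (hu : u ∈ R) (hv : v ∈ R) {e : Sym2 V} (heu : e ∈ zblock E s T u) (hev : e ∈ zblock E s T v) :
    (s(s, u) ∈ T ↔ s(s, v) ∈ T) := by
  have hus : u ≠ s := fun h => hRs (h ▸ hu)
  have hvs : v ≠ s := fun h => hRs (h ▸ hv)
  have heE : e ∈ E := heu.1
  -- for `w ∈ R`: a zone vertex `z` of `w` has spoke colour `χ_w`; an edge with exactly one endpoint in `J_w` has colour `χ_w`
  have A3 : ∀ w ∈ R, ∀ z ∈ zone E s T w, (s(s, z) ∈ T ↔ s(s, w) ∈ T) := fun w hw z hz =>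
    have hws : w ≠ s := fun h => hRs (h ▸ hw)
    spoke_iff_of_mem_zone hws (hcone w hws) (hT w hw) hz (hcone z (ne_apex_of_mem_zone hws hz))
  induction e using Sym2.ind with
  | h a b =>
    have A4 : ∀ w ∈ R, ¬ (a ∈ zone E s T w ∧ b ∈ zone E s T w) → (a ∈ zone E s T w ∨ b ∈ zone E s T w) →
        (s(a, b) ∈ T ↔ s(s, w) ∈ T) := by
      intro w hw hnot hor
      have hws : w ≠ s := fun h => hRs (h ▸ hw)
      rcases hor with ha | hb
      · have hb : b ∉ zone E s T w := fun hb => hnot ⟨ha, hb⟩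
        rw [Sym2.eq_swap]
        exact boundary_iff hws (hcone w hws) (hT w hw) hb ha (by rw [Sym2.eq_swap]; exact heE)
      · have ha : a ∉ zone E s T w := fun ha => hnot ⟨ha, hb⟩
        exact boundary_iff hws (hcone w hws) (hT w hw) ha hb heE
    have horu : a ∈ zone E s T u ∨ b ∈ zone E s T u := by
      obtain ⟨_, x, hx, hxe⟩ := heu
      rcases Sym2.mem_iff.1 hxe with rfl | rfl
      · exact Or.inl hx
      · exact Or.inr hx
    have horv : a ∈ zone E s T v ∨ b ∈ zone E s T v := by
      obtain ⟨_, x, hx, hxe⟩ := hev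
      rcases Sym2.mem_iff.1 hxe with rfl | rfl
      · exact Or.inl hx
      · exact Or.inr hx
    by_cases hbu : a ∈ zone E s T u ∧ b ∈ zone E s T u
    · by_cases hbv : a ∈ zone E s T v ∧ b ∈ zone E s T v
      · exact (A3 u hu a hbu.1).symm.trans (A3 v hv a hbv.1)
      · rcases horv with ha | hb
        · exact (A3 u hu a hbu.1).symm.trans (A3 v hv a ha)
        · exact (A3 u hu b hbu.2).symm.trans (A3 v hv b hb)
    · by_cases hbv : a ∈ zone E s T v ∧ b ∈ zone E s T v
      · rcases horu with ha | hb
        · exact (A3 u hu a ha).symm.trans (A3 v hv a hbv.1)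
        · exact (A3 u hu b hb).symm.trans (A3 v hv b hbv.2)
      · exact (A4 u hu hbu horu).symm.trans (A4 v hv hbv horv)

/-- The top colouring on a zone block: `e ∈ N_T ↔ (e ∈ T ↔ su ∈ T)` for `e ∈ S(J_u)`. [this work] -/
theorem mem_ztop_iff (hcons : ∀ u ∈ R, ∀ v ∈ R, ∀ e, e ∈ zblock E s T u → e ∈ zblock E s T v → (s(s, u) ∈ T ↔ s(s, v) ∈ T))
    {u : V} (hu : u ∈ R) {e : Sym2 V} (he : e ∈ zblock E s T u) :
    (e ∈ ztop E s R T ↔ (e ∈ T ↔ s(s, u) ∈ T)) := by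
  constructor
  · exact fun h => h u hu he
  · intro h v hv hev
    exact h.trans (hcons u hu v hv e he hev)

/-- Boundary edges of a zone (spokes included) are red in the top colouring. [this work] -/
theorem boundary_mem_ztop (hRN : ∀ u ∈ R, s(s, u) ∈ E) (hRs : s ∉ R)
    (hT : ∀ r ∈ R, ¬ ((openGraph (T ∩ E)).Reachable s r ∧ (openGraph (Tᶜ ∩ E)).Reachable s r))
    (hcons : ∀ u ∈ R, ∀ v ∈ R, ∀ e, e ∈ zblock E s T u → e ∈ zblock E s T v → (s(s, u) ∈ T ↔ s(s, v) ∈ T))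
    {u : V} (hu : u ∈ R) {x y : V} (hx : x ∉ zone E s T u) (hy : y ∈ zone E s T u) (hxy : s(x, y) ∈ E) :
    s(x, y) ∈ ztop E s R T := by
  have hus : u ≠ s := fun h => hRs (h ▸ hu)
  exact (mem_ztop_iff hcons hu ⟨hxy, y, hy, Sym2.mem_mk_right x y⟩).2
    (boundary_iff hus (hRN u hu) (hT u hu) hx hy hxy)

/-- On a zone block the top colouring is `T` or `Tᶜ` according to the colour of the spoke. [this work] -/
theorem ztop_agree (hcons : ∀ u ∈ R, ∀ v ∈ R, ∀ e, e ∈ zblock E s T u → e ∈ zblock E s T v → (s(s, u) ∈ T ↔ s(s, v) ∈ T))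
    {u : V} (hu : u ∈ R) {A : Set (Sym2 V)} (hA : A ∈ zalg E s R T) :
    (∀ e ∈ zblock E s T u, (e ∈ ztop E s R T ∆ A ↔ e ∈ T)) ∨
      (∀ e ∈ zblock E s T u, (e ∈ ztop E s R T ∆ A ↔ e ∉ T)) := by
  rcases hA u hu with h | h
  · -- block inside `A`: flipped
    by_cases hsu : s(s, u) ∈ T
    · right
      intro e he
      rw [Set.mem_symmDiff, mem_ztop_iff hcons hu he]
      have := h he
      tauto
    · left
      intro e he
      rw [Set.mem_symmDiff, mem_ztop_iff hcons hu he]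
      have := h he
      tauto
  · -- block disjoint from `A`: as in the top
    by_cases hsu : s(s, u) ∈ T
    · left
      intro e he
      rw [Set.mem_symmDiff, mem_ztop_iff hcons hu he]
      have := Set.disjoint_left.1 h he
      tauto
    · right
      intro e he
      rw [Set.mem_symmDiff, mem_ztop_iff hcons hu he]
      have := Set.disjoint_left.1 h he
      tauto

/-- `T` lies in its own part. [this work] -/
theorem mem_zpart_self [Fintype V] (hcons : ∀ u ∈ R, ∀ v ∈ R, ∀ e, e ∈ zblock E s T u → e ∈ zblock E s T v → (s(s, u) ∈ T ↔ s(s, v) ∈ T)) :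
    T ∈ zpart E s R T := by
  rw [zpart, Finset.mem_image]
  refine ⟨ztop E s R T ∆ T, ?_, symmDiff_symmDiff_cancel_left _ _⟩
  rw [Finset.mem_filter]
  refine ⟨Finset.mem_univ _, fun u hu => ?_⟩
  by_cases hsu : s(s, u) ∈ T
  · right
    rw [Set.disjoint_left]
    intro e he
    rw [Set.mem_symmDiff, mem_ztop_iff hcons hu he]
    tauto
  · left
    intro e he
    rw [Set.mem_symmDiff, mem_ztop_iff hcons hu he]
    tauto

/-- **Validity** (THEOREM-I-cones.md Claim 1): along the block algebra the red edge cluster of `N_T ∆ A` is antitone in `A` — the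
zones inside the larger set are sealed, all other edges are at least as red. [this work] -/
theorem red_antitone (hRN : ∀ u ∈ R, s(s, u) ∈ E) (hRs : s ∉ R)
    (hT : ∀ r ∈ R, ¬ ((openGraph (T ∩ E)).Reachable s r ∧ (openGraph (Tᶜ ∩ E)).Reachable s r))
    (hcons : ∀ u ∈ R, ∀ v ∈ R, ∀ e, e ∈ zblock E s T u → e ∈ zblock E s T v → (s(s, u) ∈ T ↔ s(s, v) ∈ T))
    {A B : Set (Sym2 V)} (hB : B ∈ zalg E s R T) (hAB : A ⊆ B) :
    openEdgeCluster ((ztop E s R T ∆ B) ∩ E) s ⊆ openEdgeCluster ((ztop E s R T ∆ A) ∩ E) s := by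
  set N := ztop E s R T with hN
  set J : Set V := {x | ∃ u ∈ R, zblock E s T u ⊆ B ∧ x ∈ zone E s T u} with hJ
  have hsJ : s ∉ J := by
    rintro ⟨u, hu, -, hsu⟩
    have hus : u ≠ s := fun h => hRs (h ▸ hu)
    exact apex_not_mem_zone hus hsu
  refine openEdgeCluster_subset_of_sealed_le _ _ s J hsJ ?_ ?_
  · -- `hle`: pairs outside the sealed zones are at least as red in `N ∆ A`
    intro x y hx hy hxy
    refine ⟨?_, hxy.2⟩
    have heB := hxy.1
    rw [Set.mem_symmDiff] at heB ⊢
    by_cases heA : s(x, y) ∈ A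
    · exact Or.inr ⟨heA, fun hn => by rcases heB with ⟨_, h⟩ | ⟨_, h⟩ <;> [exact h (hAB heA); exact h hn]⟩
    · by_cases heB' : s(x, y) ∈ B
      · -- `e ∈ B \ A`: then `e ∉ N`, so some block containing `e` is badly coloured, inside `B`, hence sealed: contradiction
        exfalso
        have hnN : s(x, y) ∉ N := by
          rcases heB with ⟨_, h⟩ | ⟨_, h⟩
          · exact absurd heB' h
          · exact h
        have hex : ∃ v ∈ R, s(x, y) ∈ zblock E s T v := by
          by_contra hcon
          apply hnN
          rw [hN]
          intro v hv hev
          exact absurd ⟨v, hv, hev⟩ hcon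
        obtain ⟨v, hv, hev⟩ := hex
        have hvB : zblock E s T v ⊆ B := by
          rcases hB v hv with h | h
          · exact h
          · exact absurd (Set.disjoint_left.1 h hev) (not_not.2 heB')
        obtain ⟨-, z, hz, hze⟩ := hev
        rcases Sym2.mem_iff.1 hze with rfl | rfl
        · exact hx ⟨v, hv, hvB, hz⟩
        · exact hy ⟨v, hv, hvB, hz⟩
      · rcases heB with ⟨h, _⟩ | ⟨h, _⟩
        · exact Or.inl ⟨h, heA⟩
        · exact absurd h heB'
  · -- `hseal`: an edge from outside `J` into `J` is a boundary edge of a zone inside `B`, red in `N`, flipped in `N ∆ B`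
    intro x y hx hy hxy
    obtain ⟨u, hu, huB, hyu⟩ := hy
    have hxu : x ∉ zone E s T u := fun h => hx ⟨u, hu, huB, h⟩
    have heN : s(x, y) ∈ N := boundary_mem_ztop hRN hRs hT hcons hu hxu hyu hxy.2
    have heB : s(x, y) ∈ B := huB ⟨hxy.2, y, hyu, Sym2.mem_mk_right x y⟩
    have := hxy.1
    rw [Set.mem_symmDiff] at this
    rcases this with ⟨_, h⟩ | ⟨_, h⟩
    · exact h heB
    · exact h heN

/-- **Parts lie in the constraint set** (THEOREM-I-cones.md Claim 2): in a member of the part of `T`, an `R`-vertex whose zone block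
is up is not joined to `s` in blue, one whose block is down is not joined in red. [this work] -/
theorem mem_constraint_of_mem_zpart [Fintype V] (hRN : ∀ u ∈ R, s(s, u) ∈ E) (hRs : s ∉ R)
    (hT : ∀ r ∈ R, ¬ ((openGraph (T ∩ E)).Reachable s r ∧ (openGraph (Tᶜ ∩ E)).Reachable s r))
    (hcons : ∀ u ∈ R, ∀ v ∈ R, ∀ e, e ∈ zblock E s T u → e ∈ zblock E s T v → (s(s, u) ∈ T ↔ s(s, v) ∈ T))
    {M : Set (Sym2 V)} (hM : M ∈ zpart E s R T) :
    ∀ r ∈ R, ¬ ((openGraph (M ∩ E)).Reachable s r ∧ (openGraph (Mᶜ ∩ E)).Reachable s r) := by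
  rw [zpart, Finset.mem_image] at hM
  obtain ⟨A, hA, rfl⟩ := hM
  rw [Finset.mem_filter] at hA
  have hA := hA.2
  intro u hu
  have hus : u ≠ s := fun h => hRs (h ▸ hu)
  have hsJ : s ∉ zone E s T u := apex_not_mem_zone hus
  rcases hA u hu with h | h
  · -- block down: the zone is sealed against red
    rintro ⟨hred, -⟩
    refine not_reachable_of_sealed _ s (zone E s T u) hsJ ?_ (mem_zone_self E s T u) hred
    intro x y hx hy hxy
    have heN : s(x, y) ∈ ztop E s R T := boundary_mem_ztop hRN hRs hT hcons hu hx hy hxy.2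
    have heA : s(x, y) ∈ A := h ⟨hxy.2, y, hy, Sym2.mem_mk_right x y⟩
    have := hxy.1
    rw [Set.mem_symmDiff] at this
    rcases this with ⟨_, h'⟩ | ⟨_, h'⟩
    · exact h' heA
    · exact h' heN
  · -- block up: the zone is sealed against blue
    rintro ⟨-, hblue⟩
    refine not_reachable_of_sealed _ s (zone E s T u) hsJ ?_ (mem_zone_self E s T u) hblue
    intro x y hx hy hxy
    have heN : s(x, y) ∈ ztop E s R T := boundary_mem_ztop hRN hRs hT hcons hu hx hy hxy.2
    have heA : s(x, y) ∉ A := fun heA => Set.disjoint_left.1 h ⟨hxy.2, y, hy, Sym2.mem_mk_right x y⟩ heA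
    have := hxy.1
    rw [Set.mem_compl_iff, Set.mem_symmDiff] at this
    exact this (Or.inl ⟨heN, heA⟩)

/-- **Parts are constant on themselves** (THEOREM-I-cones.md Claim 3): every member of the part of `T` has the same zones, hence
the same blocks, block algebra, top and part. [this work] -/
theorem zpart_eq_of_mem [Fintype V] (hRN : ∀ u ∈ R, s(s, u) ∈ E)
    (hcons : ∀ u ∈ R, ∀ v ∈ R, ∀ e, e ∈ zblock E s T u → e ∈ zblock E s T v → (s(s, u) ∈ T ↔ s(s, v) ∈ T))
    {M : Set (Sym2 V)} (hM : M ∈ zpart E s R T) : zpart E s R M = zpart E s R T := by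
  rw [zpart, Finset.mem_image] at hM
  obtain ⟨A, hA, rfl⟩ := hM
  rw [Finset.mem_filter] at hA
  have hA := hA.2
  have hzone : ∀ u ∈ R, zone E s (ztop E s R T ∆ A) u = zone E s T u := fun u hu =>
    zone_eq_of_agree (hRN u hu) (ztop_agree hcons hu hA)
  have hblk : ∀ u ∈ R, zblock E s (ztop E s R T ∆ A) u = zblock E s T u := fun u hu => by
    simp only [zblock, hzone u hu]
  have halg : ∀ B, B ∈ zalg E s R (ztop E s R T ∆ A) ↔ B ∈ zalg E s R T := fun B =>
    forall₂_congr fun u hu => by rw [hblk u hu]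
  have htop : ztop E s R (ztop E s R T ∆ A) = ztop E s R T := by
    ext e
    show (∀ u ∈ R, e ∈ zblock E s (ztop E s R T ∆ A) u → (e ∈ ztop E s R T ∆ A ↔ s(s, u) ∈ ztop E s R T ∆ A)) ↔
      (∀ u ∈ R, e ∈ zblock E s T u → (e ∈ T ↔ s(s, u) ∈ T))
    refine forall₂_congr fun u hu => ?_
    rw [hblk u hu]
    refine imp_congr_right fun he => ?_
    have hsub : s(s, u) ∈ zblock E s T u := spoke_mem_zblock (hRN u hu)
    rcases ztop_agree hcons hu hA with h | h
    · rw [h e he, h _ hsub]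
    · rw [h e he, h _ hsub]
      tauto
  rw [zpart, zpart, htop]
  congr 1
  ext B
  simp only [Finset.mem_filter, Finset.mem_univ, true_and]
  exact halg B

/-- **Every part has a nonnegative antithetic sum** — Harris on the block algebra (`piece_algebra_sum_nonneg`) with the validity
`red_antitone`. [this work] -/
theorem zpart_sum_nonneg [Fintype V] (hRN : ∀ u ∈ R, s(s, u) ∈ E) (hRs : s ∉ R)
    (hT : ∀ r ∈ R, ¬ ((openGraph (T ∩ E)).Reachable s r ∧ (openGraph (Tᶜ ∩ E)).Reachable s r))
    (hcons : ∀ u ∈ R, ∀ v ∈ R, ∀ e, e ∈ zblock E s T u → e ∈ zblock E s T v → (s(s, u) ∈ T ↔ s(s, v) ∈ T))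
    {F G : Set (Sym2 V) → ℝ} (hF : Monotone F) (hG : Monotone G) :
    0 ≤ ∑ M ∈ zpart E s R T, (F (openEdgeCluster (M ∩ E) s) - F (openEdgeCluster (Mᶜ ∩ E) s)) *
      (G (openEdgeCluster (M ∩ E) s) - G (openEdgeCluster (Mᶜ ∩ E) s)) := by
  rw [zpart]
  refine piece_algebra_sum_nonneg E s (ztop E s R T) _ ?_ ?_ ?_ ?_ ?_ hF hG
  · intro A hA B hB
    rw [Finset.mem_filter] at hA hB ⊢
    exact ⟨Finset.mem_univ _, blockAlgebra_inter R (zblock E s T) hA.2 hB.2⟩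
  · intro A hA B hB
    rw [Finset.mem_filter] at hA hB ⊢
    exact ⟨Finset.mem_univ _, blockAlgebra_union R (zblock E s T) hA.2 hB.2⟩
  · intro A hA
    rw [Finset.mem_filter] at hA ⊢
    exact ⟨Finset.mem_univ _, blockAlgebra_compl R (zblock E s T) hA.2⟩
  · rw [Finset.mem_filter]
    exact ⟨Finset.mem_univ _, blockAlgebra_empty R (zblock E s T)⟩
  · intro A hA B hB hAB
    rw [Finset.mem_filter] at hB
    exact red_antitone hRN hRs hT hcons hB.2 hAB

end Partition

end Cone

section TheoremI

variable {V : Type*} [Fintype V]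

/-- **THEOREM I (prim-hp-2 gen 35/36): BIC on cones.**  `E` an edge set on a finite vertex type whose apex `s` is adjacent to every
other vertex, `R ∌ s`, `F, G` increasing in the edge cluster:
`0 ≤ Σ_{ω : no r ∈ R is joined to s both in ω ∩ E and in ωᶜ ∩ E} (F(C_s(ω∩E)) − F(C_s(ωᶜ∩E))) · (G(C_s(ω∩E)) − G(C_s(ωᶜ∩E)))`
(fans, wheels, complete graphs, cones over arbitrary graphs; every avoidance set `R`).  Proof: zone partition (module docstring). [this work] -/
theorem cone_bic_nonneg (E : Set (Sym2 V)) (s : V) (hcone : ∀ v, v ≠ s → s(s, v) ∈ E) (R : Set V) (hRs : s ∉ R)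
    {F G : Set (Sym2 V) → ℝ} (hF : Monotone F) (hG : Monotone G) :
    0 ≤ ∑ ω ∈ Finset.univ.filter (fun ω : Set (Sym2 V) =>
        ∀ r ∈ R, ¬ ((openGraph (ω ∩ E)).Reachable s r ∧ (openGraph (ωᶜ ∩ E)).Reachable s r)),
      (F (openEdgeCluster (ω ∩ E) s) - F (openEdgeCluster (ωᶜ ∩ E) s)) *
        (G (openEdgeCluster (ω ∩ E) s) - G (openEdgeCluster (ωᶜ ∩ E) s)) := by
  have hRN : ∀ u ∈ R, s(s, u) ∈ E := fun u hu => hcone u fun h => hRs (h ▸ hu)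
  have hcons : ∀ T : Set (Sym2 V), (∀ r ∈ R, ¬ ((openGraph (T ∩ E)).Reachable s r ∧ (openGraph (Tᶜ ∩ E)).Reachable s r)) →
      ∀ u ∈ R, ∀ v ∈ R, ∀ e, e ∈ Cone.zblock E s T u → e ∈ Cone.zblock E s T v → (s(s, u) ∈ T ↔ s(s, v) ∈ T) :=
    fun T hT u hu v hv e heu hev => Cone.spoke_iff_of_mem_zblock hcone hRs hT hu hv heu hev
  refine sum_nonneg_of_parts _ _ (Cone.zpart E s R) ?_ ?_ ?_ ?_
  · intro T hT
    rw [Finset.mem_filter] at hT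
    exact Cone.mem_zpart_self (hcons T hT.2)
  · intro T hT M hM
    rw [Finset.mem_filter] at hT ⊢
    exact ⟨Finset.mem_univ _, Cone.mem_constraint_of_mem_zpart hRN hRs hT.2 (hcons T hT.2) hM⟩
  · intro T hT M hM
    rw [Finset.mem_filter] at hT
    exact Cone.zpart_eq_of_mem hRN (hcons T hT.2) hM
  · intro T hT
    rw [Finset.mem_filter] at hT
    exact Cone.zpart_sum_nonneg hRN hRs hT.2 (hcons T hT.2) hF hG

/-- **BIC for one constrained neighbour, on every finite graph**: `E` any edge set on a finite vertex type, `u ≠ s` with `su ∈ E`,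
`F, G` increasing: `0 ≤ Σ_{ω : u is not joined to s both in ω ∩ E and in ωᶜ ∩ E} (F(C_s(ω∩E)) − F(C_s(ωᶜ∩E)))·(G(C_s(ω∩E)) − G(C_s(ωᶜ∩E)))`,
i.e. `BIC_G({u}) ≥ 0`.  Zone partition with one zone: no consistency between zones is needed, hence no cone hypothesis. [this work] -/
theorem bic_single_nonneg (E : Set (Sym2 V)) (s u : V) (hus : u ≠ s) (hsu : s(s, u) ∈ E)
    {F G : Set (Sym2 V) → ℝ} (hF : Monotone F) (hG : Monotone G) :
    0 ≤ ∑ ω ∈ Finset.univ.filter (fun ω : Set (Sym2 V) =>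
        ¬ ((openGraph (ω ∩ E)).Reachable s u ∧ (openGraph (ωᶜ ∩ E)).Reachable s u)),
      (F (openEdgeCluster (ω ∩ E) s) - F (openEdgeCluster (ωᶜ ∩ E) s)) *
        (G (openEdgeCluster (ω ∩ E) s) - G (openEdgeCluster (ωᶜ ∩ E) s)) := by
  have hRs : s ∉ ({u} : Set V) := fun h => hus (Set.mem_singleton_iff.1 h).symm
  have hRN : ∀ v ∈ ({u} : Set V), s(s, v) ∈ E := fun v hv => by
    rw [Set.mem_singleton_iff.1 hv]; exact hsu
  have hcons : ∀ T : Set (Sym2 V), ∀ v ∈ ({u} : Set V), ∀ w ∈ ({u} : Set V), ∀ e, e ∈ Cone.zblock E s T v →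
      e ∈ Cone.zblock E s T w → (s(s, v) ∈ T ↔ s(s, w) ∈ T) := fun T v hv w hw e _ _ => by
    rw [Set.mem_singleton_iff.1 hv, Set.mem_singleton_iff.1 hw]
  have hD : (Finset.univ.filter fun ω : Set (Sym2 V) =>
        ¬ ((openGraph (ω ∩ E)).Reachable s u ∧ (openGraph (ωᶜ ∩ E)).Reachable s u)) =
      Finset.univ.filter fun ω : Set (Sym2 V) =>
        ∀ r ∈ ({u} : Set V), ¬ ((openGraph (ω ∩ E)).Reachable s r ∧ (openGraph (ωᶜ ∩ E)).Reachable s r) := by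
    refine Finset.filter_congr fun ω _ => ?_
    simp only [Set.mem_singleton_iff, forall_eq]
  rw [hD]
  refine sum_nonneg_of_parts _ _ (Cone.zpart E s {u}) ?_ ?_ ?_ ?_
  · intro T _
    exact Cone.mem_zpart_self (hcons T)
  · intro T hT M hM
    rw [Finset.mem_filter] at hT ⊢
    exact ⟨Finset.mem_univ _, Cone.mem_constraint_of_mem_zpart hRN hRs hT.2 (hcons T) hM⟩
  · intro T _ M hM
    exact Cone.zpart_eq_of_mem hRN (hcons T) hM
  · intro T hT
    rw [Finset.mem_filter] at hT
    exact Cone.zpart_sum_nonneg hRN hRs hT.2 (hcons T) hF hG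

end TheoremI

end Antithetic

end Summit.CriticalPhenomena.PercolationContinuityZ3.Theorems
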